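import Literature.NumberTheory.Automorphic.Zelevinsky1980.MaximalParabolicModulus
import Literature.NumberTheory.Automorphic.ParabolicGLExactProofs
import Literature.NumberTheory.Automorphic.ParabolicInductionProofs
import Literature.NumberTheory.Automorphic.UniformizerSeparatesCharacters
import Literature.NumberTheory.Automorphic.Liu2021.LemD1SplitPlaceOfFacts
import HarnessLib

/-!
# The inducing datum `σ' = ((ν₀ ∘ det) ⊠ χ′) ∘ proj ⊗ δ^{1/2}` of `(ν₀ ∘ det_{GL_{N-1}}) × χ′`: smoothness, triviality on `U`, exponents

Topic `NumberTheory/Automorphic/Zelevinsky1980`; theorems only (no definition, no named fact).  Let `F` be a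
non-archimedean local field with `q_F = #𝓀_F`, `N = n + 2`, `P = Q_{N-1,1} = standardParabolicGL F (lastBlockLabel N)`,
`ν₀, χ′ : Fˣ → ℂˣ` characters, and
`σ' = twist (((𝟙).twist (maxParabolicLeviChar F N ν₀ χ′)) ∘ leviProjection) (rootDeltaChar P)` the one-dimensional
representation of `P` from which the tree's `Representation.parabolicIndGL F (lastBlockLabel N) (𝟙.twist (maxParabolicLeviChar …))`
is induced (`parabolicIndGL = smoothIndRep P σ'` by `rfl`).  This file is the bookkeeping shared by the `N ≥ 3` and
`N = 2` branches of the irreducibility of `(ν₀ ∘ det) × χ′` (named fact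
`Zelevinsky1980.parabolicIndGL_detChar_unitary_isIrreducible`; endomorphism criterion
`Zelevinsky1980.exists_intertwiningMap_eq_smul` of `InducedMaximalParabolicEndomorphisms`, whose hypotheses `hσ'`,
`hU`, `hne` are produced here):

* `detCharDatum_apply` — `σ'(p) z = δ^{1/2}(p) · ν₀(det A) χ′(λ) · z` for `p = ((A, *), (0, λ))`;
* `detCharDatum_isSmooth` — `σ'` is smooth for continuous `ν₀, χ′`;
* `detCharDatum_eq_one_of_mem_unipotentRadicalP` — `σ' = 1` on the unipotent radical (`hU`);
* `det_leviProjection_diagGL` — the Levi blocks of a diagonal matrix have determinant the product of its entries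
  in the block; hence `maxParabolicLeviChar` at `d(t) = diag(1,…,1,t)` is `χ′(t)` and at `d₀(t) = diag(t,1,…,1)` is
  `ν₀(t)` (`maxParabolicLeviChar_leviProjection_diag_last` / `_zero`);
* `coe_rootDeltaChar_diag_last_uniformizer` / `_zero_…` — `δ^{1/2}(d(ϖ)) = √q_F^{n+1}`, `δ^{1/2}(d₀(ϖ)) = (√q_F)⁻¹`
  (from `Zelevinsky1980/MaximalParabolicModulus`);
* `detCharDatum_diag_last_uniformizer` / `detCharDatum_diag_zero_uniformizer` — the CLOSED-orbit exponent
  `σ'(d(ϖ)) 1 = χ′(ϖ) √q_F^{n+1}` and the value `σ'(d₀(ϖ)) 1 = ν₀(ϖ) (√q_F)⁻¹` (so the OPEN-orbit exponent is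
  `q_F σ'(d₀(ϖ)) 1 = ν₀(ϖ) √q_F`);
* `residueFieldCard_mul_detCharDatum_ne` — **`hne` for `N ≥ 3`**: for UNITARY `ν₀, χ′` and `n ≥ 1` the two exponents
  differ (their norms are `√q_F ≠ √q_F^{n+1}`);
* `residueFieldCard_mul_detCharDatum_ne_iff` — **`N = 2`**: the exponents differ iff `ν₀(ϖ) ≠ χ′(ϖ)`, and
  `exists_isUniformizingElement_detCharDatum_ne` — for `ν₀ ≠ χ′` SOME uniformizer achieves this
  (`exists_isUniformizingElement_map_ne` of `UniformizerSeparatesCharacters`).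

(Bernstein–Zelevinsky 1977, §7.1: the two `(Q_{N-1,1}, Q_{N-1,1})`-orbits contribute `σ'` and `i ∘ w ∘ r(σ')` with
exponents `χ′ ν^{(N-1)/2}` and `ν₀ ν^{1/2}` at `d(ϖ)`; Zelevinsky 1980, §3.1–3.2, §4.2.)

## References

* I. N. Bernstein, A. V. Zelevinsky, *Induced representations of reductive `p`-adic groups I*, Ann. Sci. ÉNS 10
  (1977), 1.7, Thm. 5.2, §7.1. [BernsteinZelevinskyASENS1977]
* A. V. Zelevinsky, *Induced representations of reductive `p`-adic groups II*, Ann. Sci. ÉNS 13 (1980), §1.1,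
  §3.1–3.2, Thm. 4.2. [Zelevinsky1980]
-/

noncomputable section

open scoped NNReal
open Matrix MeasureTheory Literature.LinearAlgebra.Matrix.DiagonalTorus

namespace Literature.NumberTheory.Automorphic

/-! ### Levi blocks of a diagonal matrix -/

/-- **The Levi blocks of a diagonal matrix**: for `p = diag(d)` (in every standard parabolic) the `a`-th diagonal block
has determinant `∏_{c i = a} d_i`. [cite: Zelevinsky1980, §1.1, p. 170] -/
theorem det_leviProjection_diagGL {R : Type*} [Field R] {m : ℕ} {α : Type*} [LinearOrder α] (c : Fin m → α)
    (d : Fin m → Rˣ) (a : α) :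
    Matrix.GeneralLinearGroup.det (leviProjection R c ⟨diagGL (Fin m) d, Zelevinsky1980.diagGL_mem_standardParabolicGL c d⟩ a) =
      ∏ i : {i // c i = a}, d i := by
  ext
  rw [Matrix.GeneralLinearGroup.val_det_apply, coe_leviProjection_apply, Units.coe_prod]
  change (((diagGL (Fin m) d : GL (Fin m) R) : Matrix (Fin m) (Fin m) R).toSquareBlock c a).det = _
  rw [val_diagGL, toSquareBlock_def]
  have : (Matrix.of fun i j : {i // c i = a} => (diagonal fun i => (d i : R)) (↑i) (↑j)) =
      diagonal fun i : {i // c i = a} => (d i : R) := by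
    ext i j
    simp only [Matrix.of_apply, diagonal_apply, Subtype.ext_iff]
  rw [this, det_diagonal]

end Literature.NumberTheory.Automorphic

namespace Literature.NumberTheory.Automorphic.Zelevinsky1980

open Literature.NumberTheory.Automorphic ValuativeRel

section General

variable (F : Type*) [Field F] [ValuativeRel F] [TopologicalSpace F] [IsNonarchimedeanLocalField F] (N : ℕ)
  (ν₀ χ' : Fˣ →* ℂˣ)

/-- **`σ'(p) z = δ^{1/2}(p) · ((ν₀ ∘ det) ⊠ χ′)(proj p) · z`** (unfolding of the inducing datum). [cite: Zelevinsky1980, §3.1, p. 180] -/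
theorem detCharDatum_apply (p : ↥(standardParabolicGL F (lastBlockLabel N))) (z : ℂ) :
    Representation.twist (((Representation.trivial ℂ (Π a : Bool, GL {i : Fin N // lastBlockLabel N i = a} F) ℂ).twist
        (maxParabolicLeviChar F N ν₀ χ')).comp (leviProjection F (lastBlockLabel N)))
      (rootDeltaChar (standardParabolicGL F (lastBlockLabel N))) p z =
      ((rootDeltaChar (standardParabolicGL F (lastBlockLabel N)) p : ℂˣ) : ℂ) *
        (((maxParabolicLeviChar F N ν₀ χ' (leviProjection F (lastBlockLabel N) p) : ℂˣ) : ℂ) * z) := by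
  rw [Representation.twist_apply, MonoidHom.comp_apply, Representation.twist_apply, Representation.trivial_apply,
    smul_eq_mul, smul_eq_mul]

/-- **The inducing datum is smooth** for CONTINUOUS `ν₀, χ′` (open kernels: `Liu2021.SplitPlace.isOpen_ker_of_continuous`,
`isOpen_ker_maxParabolicLeviChar`, then `Representation.IsSmooth.twist_comp_leviProjection`) — hypothesis `hσ'` of
`exists_intertwiningMap_eq_smul`. [cite: BernsteinZelevinskyASENS1977, §1.8] -/
theorem detCharDatum_isSmooth [LocallyCompactSpace (standardParabolicGL F (lastBlockLabel N))]
    (hν₀c : Continuous fun x => ((ν₀ x : ℂˣ) : ℂ)) (hχ'c : Continuous fun x => ((χ' x : ℂˣ) : ℂ)) :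
    (Representation.twist (((Representation.trivial ℂ (Π a : Bool, GL {i : Fin N // lastBlockLabel N i = a} F) ℂ).twist
        (maxParabolicLeviChar F N ν₀ χ')).comp (leviProjection F (lastBlockLabel N)))
      (rootDeltaChar (standardParabolicGL F (lastBlockLabel N)))).IsSmooth :=
  Representation.IsSmooth.twist_comp_leviProjection F (lastBlockLabel N)
    (Liu2021.SplitPlace.isAdmissible_trivial_twist _
      (Liu2021.SplitPlace.isOpen_ker_maxParabolicLeviChar N ν₀ χ'
        (Liu2021.SplitPlace.isOpen_ker_of_continuous ν₀ hν₀c)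
        (Liu2021.SplitPlace.isOpen_ker_of_continuous χ' hχ'c))).isSmooth

/-- **The inducing datum is trivial on the unipotent radical** `U` of `Q_{N-1,1}` (`δ^{1/2}|_U = 1` by
`rootDeltaChar_eq_one_of_mem_unipotentRadicalP`, `proj|_U = 1`) — hypothesis `hU` of `exists_intertwiningMap_eq_smul`.
[cite: BernsteinZelevinskyASENS1977, §1.8] -/
theorem detCharDatum_eq_one_of_mem_unipotentRadicalP [LocallyCompactSpace (standardParabolicGL F (lastBlockLabel N))]
    (u : ↥(standardParabolicGL F (lastBlockLabel N))) (hu : u ∈ unipotentRadicalP F (lastBlockLabel N)) :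
    Representation.twist (((Representation.trivial ℂ (Π a : Bool, GL {i : Fin N // lastBlockLabel N i = a} F) ℂ).twist
        (maxParabolicLeviChar F N ν₀ χ')).comp (leviProjection F (lastBlockLabel N)))
      (rootDeltaChar (standardParabolicGL F (lastBlockLabel N))) u = 1 := by
  apply LinearMap.ext
  intro z
  have hproj : leviProjection F (lastBlockLabel N) u = 1 := hu
  rw [detCharDatum_apply, rootDeltaChar_eq_one_of_mem_unipotentRadicalP F (lastBlockLabel N) hu, hproj, map_one,
    Units.val_one, one_mul, one_mul, Module.End.one_apply]

end General

section Exponents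

variable (F : Type*) [Field F] [ValuativeRel F] [TopologicalSpace F] [IsNonarchimedeanLocalField F] {n : ℕ}
  (ν₀ χ' : Fˣ →* ℂˣ)

omit [ValuativeRel F] [TopologicalSpace F] [IsNonarchimedeanLocalField F] in
/-- `(ν₀ ∘ det) ⊠ χ′` at `d(t) = diag(1, …, 1, t)` is `χ′(t)`. [cite: Zelevinsky1980, §3.2, p. 181] -/
theorem maxParabolicLeviChar_leviProjection_diag_last (t : Fˣ) :
    maxParabolicLeviChar F (n + 2) ν₀ χ'
        (leviProjection F (lastBlockLabel (n + 2))
          ⟨diagGL (Fin (n + 2)) (Function.update 1 (Fin.last (n + 1)) t), diagGL_mem_standardParabolicGL _ _⟩) = χ' t := by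
  rw [maxParabolicLeviChar_apply, det_leviProjection_diagGL, det_leviProjection_diagGL]
  have hlast : lastBlockLabel (n + 2) (Fin.last (n + 1)) = true := by
    rw [lastBlockLabel_apply, Fin.val_last, decide_eq_true (le_refl _)]
  have hfalse : ∏ i : {i : Fin (n + 2) // lastBlockLabel (n + 2) i = false},
      Function.update (1 : Fin (n + 2) → Fˣ) (Fin.last (n + 1)) t i = 1 := by
    refine Fintype.prod_eq_one _ fun i => ?_
    have hi : (i : Fin (n + 2)) ≠ Fin.last (n + 1) := by
      intro h
      have := i.2
      rw [h, hlast] at this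
      exact Bool.noConfusion this
    rw [Function.update_of_ne hi, Pi.one_apply]
  have htrue : ∏ i : {i : Fin (n + 2) // lastBlockLabel (n + 2) i = true},
      Function.update (1 : Fin (n + 2) → Fˣ) (Fin.last (n + 1)) t i = t := by
    rw [Fintype.prod_eq_single (⟨Fin.last (n + 1), hlast⟩ : {i : Fin (n + 2) // lastBlockLabel (n + 2) i = true})]
    · exact Function.update_self _ _ _
    · intro i hi
      have hi' : (i : Fin (n + 2)) ≠ Fin.last (n + 1) := fun h => hi (Subtype.ext h)
      rw [Function.update_of_ne hi', Pi.one_apply]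
  rw [hfalse, htrue, map_one, one_mul]

omit [ValuativeRel F] [TopologicalSpace F] [IsNonarchimedeanLocalField F] in
/-- `(ν₀ ∘ det) ⊠ χ′` at `d₀(t) = diag(t, 1, …, 1)` is `ν₀(t)` (`N = n + 2 ≥ 2`). [cite: Zelevinsky1980, §3.2, p. 181] -/
theorem maxParabolicLeviChar_leviProjection_diag_zero (t : Fˣ) :
    maxParabolicLeviChar F (n + 2) ν₀ χ'
        (leviProjection F (lastBlockLabel (n + 2))
          ⟨diagGL (Fin (n + 2)) (Function.update 1 0 t), diagGL_mem_standardParabolicGL _ _⟩) = ν₀ t := by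
  rw [maxParabolicLeviChar_apply, det_leviProjection_diagGL, det_leviProjection_diagGL]
  have h0false : lastBlockLabel (n + 2) 0 = false := by
    rw [lastBlockLabel_apply, Fin.val_zero, decide_eq_false (by omega)]
  have htrue : ∏ i : {i : Fin (n + 2) // lastBlockLabel (n + 2) i = true},
      Function.update (1 : Fin (n + 2) → Fˣ) 0 t i = 1 := by
    refine Fintype.prod_eq_one _ fun i => ?_
    have hi : (i : Fin (n + 2)) ≠ 0 := by
      intro h
      have := i.2
      rw [h, h0false] at this
      exact Bool.noConfusion this
    rw [Function.update_of_ne hi, Pi.one_apply]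
  have hfalse : ∏ i : {i : Fin (n + 2) // lastBlockLabel (n + 2) i = false},
      Function.update (1 : Fin (n + 2) → Fˣ) 0 t i = t := by
    rw [Fintype.prod_eq_single (⟨0, h0false⟩ : {i : Fin (n + 2) // lastBlockLabel (n + 2) i = false})]
    · exact Function.update_self _ _ _
    · intro i hi
      have hi' : (i : Fin (n + 2)) ≠ 0 := fun h => hi (Subtype.ext h)
      rw [Function.update_of_ne hi', Pi.one_apply]
  rw [hfalse, htrue, map_one, mul_one]

/-- **`δ^{1/2}(d(ϖ)) = √q_F^{n+1}`** (from `modularCharacter_diag_last_uniformizer`: `Δ(d(ϖ)) = q_F^{N-1}`).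
[cite: BernsteinZelevinskyASENS1977, 1.7] -/
theorem coe_rootDeltaChar_diag_last_uniformizer {ϖ : F} (hϖ : IsUniformizingElement ϖ) :
    ((rootDeltaChar (standardParabolicGL F (lastBlockLabel (n + 2)))
        ⟨diagGL (Fin (n + 2)) (Function.update 1 (Fin.last (n + 1)) (Units.mk0 ϖ hϖ.ne_zero)),
          diagGL_mem_standardParabolicGL _ _⟩ : ℂˣ) : ℂ) =
      (Real.sqrt (GaloisRepresentations.IsNonarchimedeanLocalField.residueFieldCard F : ℝ) : ℂ) ^ (n + 1) := by
  rw [rootDeltaChar_apply, modularCharacter_diag_last_uniformizer hϖ, ← Complex.ofReal_pow]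
  congr 1
  rw [Real.coe_sqrt, NNReal.coe_pow, NNReal.coe_natCast]
  have hq0 : (0 : ℝ) ≤ (GaloisRepresentations.IsNonarchimedeanLocalField.residueFieldCard F : ℝ) := Nat.cast_nonneg _
  rw [Real.sqrt_eq_iff_eq_sq (pow_nonneg hq0 _) (pow_nonneg (Real.sqrt_nonneg _) _), ← pow_mul, mul_comm, pow_mul,
    Real.sq_sqrt hq0]

/-- **`δ^{1/2}(d₀(ϖ)) = (√q_F)⁻¹`** (from `modularCharacter_diag_zero_uniformizer`: `Δ(d₀(ϖ)) = q_F⁻¹`).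
[cite: BernsteinZelevinskyASENS1977, 1.7] -/
theorem coe_rootDeltaChar_diag_zero_uniformizer {ϖ : F} (hϖ : IsUniformizingElement ϖ) :
    ((rootDeltaChar (standardParabolicGL F (lastBlockLabel (n + 2)))
        ⟨diagGL (Fin (n + 2)) (Function.update 1 0 (Units.mk0 ϖ hϖ.ne_zero)), diagGL_mem_standardParabolicGL _ _⟩ : ℂˣ) : ℂ) =
      (Real.sqrt (GaloisRepresentations.IsNonarchimedeanLocalField.residueFieldCard F : ℝ) : ℂ)⁻¹ := by
  rw [rootDeltaChar_apply, modularCharacter_diag_zero_uniformizer hϖ, ← Complex.ofReal_inv]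
  congr 1
  rw [NNReal.sqrt_inv, NNReal.coe_inv, Real.coe_sqrt, NNReal.coe_natCast]

/-- **The closed-orbit exponent**: `σ'(d(ϖ)) 1 = χ′(ϖ) · √q_F^{n+1}` (= `χ′(ϖ) q_F^{(N-1)/2}`).
[cite: BernsteinZelevinskyASENS1977, §7.1] -/
theorem detCharDatum_diag_last_uniformizer {ϖ : F} (hϖ : IsUniformizingElement ϖ) :
    Representation.twist (((Representation.trivial ℂ (Π a : Bool, GL {i : Fin (n + 2) // lastBlockLabel (n + 2) i = a} F) ℂ).twist
        (maxParabolicLeviChar F (n + 2) ν₀ χ')).comp (leviProjection F (lastBlockLabel (n + 2))))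
      (rootDeltaChar (standardParabolicGL F (lastBlockLabel (n + 2))))
      ⟨diagGL (Fin (n + 2)) (Function.update 1 (Fin.last (n + 1)) (Units.mk0 ϖ hϖ.ne_zero)),
        diagGL_mem_standardParabolicGL _ _⟩ 1 =
      ((χ' (Units.mk0 ϖ hϖ.ne_zero) : ℂˣ) : ℂ) *
        (Real.sqrt (GaloisRepresentations.IsNonarchimedeanLocalField.residueFieldCard F : ℝ) : ℂ) ^ (n + 1) := by
  rw [detCharDatum_apply, coe_rootDeltaChar_diag_last_uniformizer F hϖ, maxParabolicLeviChar_leviProjection_diag_last,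
    mul_one, mul_comm]

/-- **The value at `d₀(ϖ)`**: `σ'(d₀(ϖ)) 1 = ν₀(ϖ) · (√q_F)⁻¹` (so the open-orbit exponent `q_F σ'(d₀(ϖ)) 1` is
`ν₀(ϖ) √q_F = ν₀(ϖ) q_F^{1/2}`). [cite: BernsteinZelevinskyASENS1977, §7.1] -/
theorem detCharDatum_diag_zero_uniformizer {ϖ : F} (hϖ : IsUniformizingElement ϖ) :
    Representation.twist (((Representation.trivial ℂ (Π a : Bool, GL {i : Fin (n + 2) // lastBlockLabel (n + 2) i = a} F) ℂ).twist
        (maxParabolicLeviChar F (n + 2) ν₀ χ')).comp (leviProjection F (lastBlockLabel (n + 2))))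
      (rootDeltaChar (standardParabolicGL F (lastBlockLabel (n + 2))))
      ⟨diagGL (Fin (n + 2)) (Function.update 1 0 (Units.mk0 ϖ hϖ.ne_zero)), diagGL_mem_standardParabolicGL _ _⟩ 1 =
      ((ν₀ (Units.mk0 ϖ hϖ.ne_zero) : ℂˣ) : ℂ) *
        (Real.sqrt (GaloisRepresentations.IsNonarchimedeanLocalField.residueFieldCard F : ℝ) : ℂ)⁻¹ := by
  rw [detCharDatum_apply, coe_rootDeltaChar_diag_zero_uniformizer F hϖ, maxParabolicLeviChar_leviProjection_diag_zero,
    mul_one, mul_comm]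

/-- **The open-orbit exponent**: `q_F · σ'(d₀(ϖ)) 1 = ν₀(ϖ) · √q_F`. [cite: BernsteinZelevinskyASENS1977, §7.1] -/
theorem residueFieldCard_mul_detCharDatum_diag_zero_uniformizer {ϖ : F} (hϖ : IsUniformizingElement ϖ) :
    (GaloisRepresentations.IsNonarchimedeanLocalField.residueFieldCard F : ℂ) *
      Representation.twist (((Representation.trivial ℂ (Π a : Bool, GL {i : Fin (n + 2) // lastBlockLabel (n + 2) i = a} F) ℂ).twist
        (maxParabolicLeviChar F (n + 2) ν₀ χ')).comp (leviProjection F (lastBlockLabel (n + 2))))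
      (rootDeltaChar (standardParabolicGL F (lastBlockLabel (n + 2))))
      ⟨diagGL (Fin (n + 2)) (Function.update 1 0 (Units.mk0 ϖ hϖ.ne_zero)), diagGL_mem_standardParabolicGL _ _⟩ 1 =
      ((ν₀ (Units.mk0 ϖ hϖ.ne_zero) : ℂˣ) : ℂ) *
        (Real.sqrt (GaloisRepresentations.IsNonarchimedeanLocalField.residueFieldCard F : ℝ) : ℂ) := by
  rw [detCharDatum_diag_zero_uniformizer F ν₀ χ' hϖ]
  have hq0 : (0 : ℝ) < (GaloisRepresentations.IsNonarchimedeanLocalField.residueFieldCard F : ℝ) := by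
    exact_mod_cast zero_lt_one.trans (GaloisRepresentations.IsNonarchimedeanLocalField.one_lt_residueFieldCard F)
  have hq : (Real.sqrt (GaloisRepresentations.IsNonarchimedeanLocalField.residueFieldCard F : ℝ) : ℂ) ≠ 0 :=
    Complex.ofReal_ne_zero.2 (Real.sqrt_ne_zero'.2 hq0)
  have hqq : (GaloisRepresentations.IsNonarchimedeanLocalField.residueFieldCard F : ℂ) =
      (Real.sqrt (GaloisRepresentations.IsNonarchimedeanLocalField.residueFieldCard F : ℝ) : ℂ) ^ 2 := by
    rw [← Complex.ofReal_pow, Real.sq_sqrt hq0.le, Complex.ofReal_natCast]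
  rw [hqq]
  calc (Real.sqrt (GaloisRepresentations.IsNonarchimedeanLocalField.residueFieldCard F : ℝ) : ℂ) ^ 2 *
        (((ν₀ (Units.mk0 ϖ hϖ.ne_zero) : ℂˣ) : ℂ) *
          ((Real.sqrt (GaloisRepresentations.IsNonarchimedeanLocalField.residueFieldCard F : ℝ) : ℂ))⁻¹)
      = ((ν₀ (Units.mk0 ϖ hϖ.ne_zero) : ℂˣ) : ℂ) *
          (Real.sqrt (GaloisRepresentations.IsNonarchimedeanLocalField.residueFieldCard F : ℝ) : ℂ) *
          ((Real.sqrt (GaloisRepresentations.IsNonarchimedeanLocalField.residueFieldCard F : ℝ) : ℂ) *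
            ((Real.sqrt (GaloisRepresentations.IsNonarchimedeanLocalField.residueFieldCard F : ℝ) : ℂ))⁻¹) := by ring
    _ = ((ν₀ (Units.mk0 ϖ hϖ.ne_zero) : ℂˣ) : ℂ) *
          (Real.sqrt (GaloisRepresentations.IsNonarchimedeanLocalField.residueFieldCard F : ℝ) : ℂ) := by
        rw [mul_inv_cancel₀ hq, mul_one]

/-- **`hne` for `N ≥ 3`.** For UNITARY `ν₀, χ′` and `n ≥ 1` (`N = n + 2 ≥ 3`) the open- and closed-orbit exponents
`q_F σ'(d₀(ϖ)) 1 = ν₀(ϖ) √q_F` and `σ'(d(ϖ)) 1 = χ′(ϖ) √q_F^{n+1}` are DIFFERENT (norms `√q_F < √q_F^{n+1}` as `q_F > 1`) —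
hypothesis `hne` of `exists_intertwiningMap_eq_smul`. [cite: BernsteinZelevinskyASENS1977, §7.1] -/
theorem residueFieldCard_mul_detCharDatum_ne (hn : 1 ≤ n) (hν₀u : ∀ x, ‖((ν₀ x : ℂˣ) : ℂ)‖ = 1)
    (hχ'u : ∀ x, ‖((χ' x : ℂˣ) : ℂ)‖ = 1) {ϖ : F} (hϖ : IsUniformizingElement ϖ) :
    (GaloisRepresentations.IsNonarchimedeanLocalField.residueFieldCard F : ℂ) *
      Representation.twist (((Representation.trivial ℂ (Π a : Bool, GL {i : Fin (n + 2) // lastBlockLabel (n + 2) i = a} F) ℂ).twist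
        (maxParabolicLeviChar F (n + 2) ν₀ χ')).comp (leviProjection F (lastBlockLabel (n + 2))))
      (rootDeltaChar (standardParabolicGL F (lastBlockLabel (n + 2))))
      ⟨diagGL (Fin (n + 2)) (Function.update 1 0 (Units.mk0 ϖ hϖ.ne_zero)), diagGL_mem_standardParabolicGL _ _⟩ 1 ≠
    Representation.twist (((Representation.trivial ℂ (Π a : Bool, GL {i : Fin (n + 2) // lastBlockLabel (n + 2) i = a} F) ℂ).twist
        (maxParabolicLeviChar F (n + 2) ν₀ χ')).comp (leviProjection F (lastBlockLabel (n + 2))))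
      (rootDeltaChar (standardParabolicGL F (lastBlockLabel (n + 2))))
      ⟨diagGL (Fin (n + 2)) (Function.update 1 (Fin.last (n + 1)) (Units.mk0 ϖ hϖ.ne_zero)),
        diagGL_mem_standardParabolicGL _ _⟩ 1 := by
  rw [residueFieldCard_mul_detCharDatum_diag_zero_uniformizer F ν₀ χ' hϖ, detCharDatum_diag_last_uniformizer F ν₀ χ' hϖ]
  intro h
  have hs : 1 < Real.sqrt (GaloisRepresentations.IsNonarchimedeanLocalField.residueFieldCard F : ℝ) := by
    rw [Real.lt_sqrt zero_le_one, one_pow]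
    exact_mod_cast GaloisRepresentations.IsNonarchimedeanLocalField.one_lt_residueFieldCard F
  have h' := congrArg (fun z : ℂ => ‖z‖) h
  simp only [norm_mul, norm_pow, Complex.norm_real, Real.norm_eq_abs, hν₀u, hχ'u, one_mul,
    abs_of_pos (zero_lt_one.trans hs)] at h'
  have hlt : Real.sqrt (GaloisRepresentations.IsNonarchimedeanLocalField.residueFieldCard F : ℝ) ^ 1 <
      Real.sqrt (GaloisRepresentations.IsNonarchimedeanLocalField.residueFieldCard F : ℝ) ^ (n + 1) :=
    pow_lt_pow_right₀ hs (by omega)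
  rw [pow_one] at hlt
  exact hlt.ne h'

/-- **`N = 2`: the exponents differ iff `ν₀(ϖ) ≠ χ′(ϖ)`** (both are `(·)(ϖ) √q_F`). [cite: BernsteinZelevinskyASENS1977, §7.1] -/
theorem residueFieldCard_mul_detCharDatum_ne_iff {ϖ : F} (hϖ : IsUniformizingElement ϖ) :
    (GaloisRepresentations.IsNonarchimedeanLocalField.residueFieldCard F : ℂ) *
      Representation.twist (((Representation.trivial ℂ (Π a : Bool, GL {i : Fin 2 // lastBlockLabel 2 i = a} F) ℂ).twist
        (maxParabolicLeviChar F 2 ν₀ χ')).comp (leviProjection F (lastBlockLabel 2)))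
      (rootDeltaChar (standardParabolicGL F (lastBlockLabel 2)))
      ⟨diagGL (Fin 2) (Function.update 1 0 (Units.mk0 ϖ hϖ.ne_zero)), diagGL_mem_standardParabolicGL _ _⟩ 1 ≠
    Representation.twist (((Representation.trivial ℂ (Π a : Bool, GL {i : Fin 2 // lastBlockLabel 2 i = a} F) ℂ).twist
        (maxParabolicLeviChar F 2 ν₀ χ')).comp (leviProjection F (lastBlockLabel 2)))
      (rootDeltaChar (standardParabolicGL F (lastBlockLabel 2)))
      ⟨diagGL (Fin 2) (Function.update 1 (Fin.last 1) (Units.mk0 ϖ hϖ.ne_zero)), diagGL_mem_standardParabolicGL _ _⟩ 1 ↔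
    ν₀ (Units.mk0 ϖ hϖ.ne_zero) ≠ χ' (Units.mk0 ϖ hϖ.ne_zero) := by
  rw [residueFieldCard_mul_detCharDatum_diag_zero_uniformizer F (n := 0) ν₀ χ' hϖ,
    detCharDatum_diag_last_uniformizer F (n := 0) ν₀ χ' hϖ, zero_add, pow_one]
  have hq0 : (0 : ℝ) < (GaloisRepresentations.IsNonarchimedeanLocalField.residueFieldCard F : ℝ) := by
    exact_mod_cast zero_lt_one.trans (GaloisRepresentations.IsNonarchimedeanLocalField.one_lt_residueFieldCard F)
  have hq : (Real.sqrt (GaloisRepresentations.IsNonarchimedeanLocalField.residueFieldCard F : ℝ) : ℂ) ≠ 0 :=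
    Complex.ofReal_ne_zero.2 (Real.sqrt_ne_zero'.2 hq0)
  rw [Ne, Ne, mul_left_inj' hq, Units.val_inj]

/-- **`N = 2`, `ν₀ ≠ χ′`: some uniformizer separates the exponents.** If `ν₀ ≠ χ′` there is a uniformizer `ϖ` with
`q_F σ'(d₀(ϖ)) 1 ≠ σ'(d(ϖ)) 1` (`exists_isUniformizingElement_map_ne`: characters agreeing on all uniformizers are
equal), so `exists_intertwiningMap_eq_smul` applies at that `ϖ`. [cite: BernsteinZelevinskyASENS1977, §7.1] -/
theorem exists_isUniformizingElement_detCharDatum_ne (hne : ν₀ ≠ χ') :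
    ∃ (ϖ : F) (hϖ : IsUniformizingElement ϖ),
      (GaloisRepresentations.IsNonarchimedeanLocalField.residueFieldCard F : ℂ) *
        Representation.twist (((Representation.trivial ℂ (Π a : Bool, GL {i : Fin 2 // lastBlockLabel 2 i = a} F) ℂ).twist
          (maxParabolicLeviChar F 2 ν₀ χ')).comp (leviProjection F (lastBlockLabel 2)))
        (rootDeltaChar (standardParabolicGL F (lastBlockLabel 2)))
        ⟨diagGL (Fin 2) (Function.update 1 0 (Units.mk0 ϖ hϖ.ne_zero)), diagGL_mem_standardParabolicGL _ _⟩ 1 ≠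
      Representation.twist (((Representation.trivial ℂ (Π a : Bool, GL {i : Fin 2 // lastBlockLabel 2 i = a} F) ℂ).twist
          (maxParabolicLeviChar F 2 ν₀ χ')).comp (leviProjection F (lastBlockLabel 2)))
        (rootDeltaChar (standardParabolicGL F (lastBlockLabel 2)))
        ⟨diagGL (Fin 2) (Function.update 1 (Fin.last 1) (Units.mk0 ϖ hϖ.ne_zero)), diagGL_mem_standardParabolicGL _ _⟩ 1 := by
  obtain ⟨ϖ, hϖ, h⟩ := exists_isUniformizingElement_map_ne hne
  exact ⟨ϖ, hϖ, (residueFieldCard_mul_detCharDatum_ne_iff F ν₀ χ' hϖ).2 h⟩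

end Exponents

end Literature.NumberTheory.Automorphic.Zelevinsky1980

end
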